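import Mathlib.LinearAlgebra.Matrix.Notation
import Mathlib.LinearAlgebra.Matrix.Trace
import Mathlib.LinearAlgebra.Matrix.Determinant.Basic
import Mathlib.Data.Real.Basic
import Mathlib.Tactic.FinCases
import Mathlib.Tactic.Linarith
import Mathlib.Tactic.LinearCombination
import Mathlib.Tactic.Ring
import Mathlib.Tactic.NormNum
import Mathlib.Tactic.Positivity

/-!
# FunctionalMining/NoGo — pointwise Betchov in 2.5D and the unshearing family (no-go seat gen 11, STAGING)

HONEST FRAMING. Search for candidate a priori estimates; no regularity claim. NS FUNCTIONAL MINING —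
NO-GO BRANCH (cell `pub-nsfunc`). Nothing about Navier–Stokes is asserted here; these are pointwise
linear-algebra identities used by the no-go branch's static sieves (SIEVE K / SIEVE Z0, DC-FAMILY.md).

*2.5D fields.* For a velocity field on `T³` that does not depend on `z`, the velocity gradient
`G i j = ∂ⱼ vᵢ` has vanishing third column: `G = !![g₀₀, g₀₁, 0; g₁₀, g₁₁, 0; p, q, 0]`.
With `S = ½(G + Gᵀ)`, `ω = (∂₂v₃ − ∂₃v₂, ∂₃v₁ − ∂₁v₃, ∂₁v₂ − ∂₂v₁)` and `σ = ωᵀ S ω`: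

* `betchov_pointwise` : `det S = −σ/4` for EVERY such `G` (Betchov's mean identity `∫det S = −¼∫σ`
  holds pointwise in 2.5D; no divergence or periodicity hypothesis is needed);
* `middle_nonpos_of_trace_zero_of_det_nonneg` : for reals `l₁ ≥ l₂ (≥ l₃)` with `l₁ + l₂ + l₃ = 0` and
  `l₁ l₂ l₃ ≥ 0`, `l₂ ≤ 0` — so in 2.5D (where `tr S = div v = 0`) the middle strain eigenvalue is
  `≤ 0` exactly where `σ ≤ 0` (vortex lines compressed), and `≥ 0` where `σ ≥ 0` (mirror lemma).

*The unshearing family* `v_ε = (0, h(x), f(y + ε h(x)))` (DC-FAMILY.md): at a point, with `a = h'(x)`,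
`b = f'(y + εh(x))`, the gradient is `unshearGrad ε a b = !![0, 0, 0; a, 0, 0; ε a b, b, 0]`, and

* `unshear_vorticity` : `ω = (b, −ε a b, a)`;
* `unshear_sigma` : `σ = −ε a² b²`, hence `σ ≤ 0` for `ε ≥ 0` (`unshear_sigma_nonpos`);
* `unshear_det` : `det S = ε a² b² / 4 ≥ 0` for `ε ≥ 0` (`unshear_det_nonneg`), `tr S = 0`.

Together: for `ε ≥ 0` every field of the family has `α = σ/|ω|² ≤ 0` and `λ₂(S) ≤ 0` at every point
(both multipliers `‖α⁺‖∞`, `‖λ₂⁺‖∞` of the census columns C3a/C3b vanish) although `σ ≢ 0`.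
*The signed-phase shear family* `v = (g(y), 0, W(x + φ(y)))` with `φ' g' ≥ 0` (v2, NOGO N19 (e)): at a point,
with `c = g'`, `t = φ'`, `w = W'`, `spsGrad c t w = grad25 0 c 0 0 w (t w)`; `sps_sigma` : `σ = −c t w²`,
`sps_det` : `det S = c t w²/4`, `sps_sigma_nonpos` / `sps_det_nonneg` under `0 ≤ c t`, `sps_sigma_diagonal` :
the unshearing family is the case `t = ε c`.

All proofs are `simp`/`ring`/`linarith` over `Fin 3`; Mathlib only. [ours, bookkeeping]
-/

namespace Summit.NavierStokesRegularity.FunctionalMining.NoGo.Unshear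

open Matrix

/-- Velocity gradient `G i j = ∂ⱼvᵢ` of a `z`-independent field at a point (third column zero). [ours] -/
def grad25 (g₀₀ g₀₁ g₁₀ g₁₁ p q : ℝ) : Matrix (Fin 3) (Fin 3) ℝ := !![g₀₀, g₀₁, 0; g₁₀, g₁₁, 0; p, q, 0]

/-- Strain `S = ½(G + Gᵀ)`. [folklore] -/
noncomputable def strainOf (G : Matrix (Fin 3) (Fin 3) ℝ) : Matrix (Fin 3) (Fin 3) ℝ := (1 / 2 : ℝ) • (G + Gᵀ)

/-- Vorticity from a velocity gradient `G i j = ∂ⱼvᵢ`. [folklore] -/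
def vorticityOfGrad (G : Matrix (Fin 3) (Fin 3) ℝ) : Fin 3 → ℝ :=
  ![G 2 1 - G 1 2, G 0 2 - G 2 0, G 1 0 - G 0 1]

/-- Stretching density `σ = ωᵀ S ω`. [folklore] -/
noncomputable def sigmaOf (G : Matrix (Fin 3) (Fin 3) ℝ) : ℝ :=
  vorticityOfGrad G ⬝ᵥ (strainOf G *ᵥ vorticityOfGrad G)

/-- Entries of the 2.5D strain. [ours, bookkeeping] -/
theorem strainOf_grad25 (g₀₀ g₀₁ g₁₀ g₁₁ p q : ℝ) :
    strainOf (grad25 g₀₀ g₀₁ g₁₀ g₁₁ p q) =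
      !![g₀₀, (g₀₁ + g₁₀) / 2, p / 2; (g₀₁ + g₁₀) / 2, g₁₁, q / 2; p / 2, q / 2, 0] := by
  ext i j
  simp only [strainOf, Matrix.smul_apply, Matrix.add_apply, Matrix.transpose_apply, smul_eq_mul]
  fin_cases i <;> fin_cases j <;> simp [grad25] <;> ring

/-- Vorticity of a 2.5D field: `ω = (q, −p, g₁₀ − g₀₁)`. [ours, bookkeeping] -/
theorem vorticity_grad25 (g₀₀ g₀₁ g₁₀ g₁₁ p q : ℝ) :
    vorticityOfGrad (grad25 g₀₀ g₀₁ g₁₀ g₁₁ p q) = ![q, -p, g₁₀ - g₀₁] := by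
  ext i
  fin_cases i <;> simp [vorticityOfGrad, grad25]

/-- `σ` of a 2.5D field in closed form. [ours, bookkeeping] -/
theorem sigma_grad25 (g₀₀ g₀₁ g₁₀ g₁₁ p q : ℝ) :
    sigmaOf (grad25 g₀₀ g₀₁ g₁₀ g₁₁ p q) = g₀₀ * q ^ 2 + g₁₁ * p ^ 2 - (g₀₁ + g₁₀) * p * q := by
  simp [sigmaOf, strainOf_grad25, vorticity_grad25, Matrix.mulVec, dotProduct, Fin.sum_univ_three]
  ring

/-- `det S` of a 2.5D field in closed form. [ours, bookkeeping] -/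
theorem det_strain_grad25 (g₀₀ g₀₁ g₁₀ g₁₁ p q : ℝ) :
    (strainOf (grad25 g₀₀ g₀₁ g₁₀ g₁₁ p q)).det =
      -(g₀₀ * q ^ 2 + g₁₁ * p ^ 2 - (g₀₁ + g₁₀) * p * q) / 4 := by
  rw [strainOf_grad25]
  simp [Matrix.det_fin_three]
  ring

/-- POINTWISE BETCHOV IN 2.5D: `det S = −σ/4` for every `z`-independent velocity gradient. [ours] -/
theorem betchov_pointwise (g₀₀ g₀₁ g₁₀ g₁₁ p q : ℝ) :
    (strainOf (grad25 g₀₀ g₀₁ g₁₀ g₁₁ p q)).det = -(sigmaOf (grad25 g₀₀ g₀₁ g₁₀ g₁₁ p q)) / 4 := by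
  rw [det_strain_grad25, sigma_grad25]

/-- `tr S = g₀₀ + g₁₁` (`= div v`). [ours, bookkeeping] -/
theorem trace_strain_grad25 (g₀₀ g₀₁ g₁₀ g₁₁ p q : ℝ) :
    (strainOf (grad25 g₀₀ g₀₁ g₁₀ g₁₁ p q)).trace = g₀₀ + g₁₁ := by
  rw [strainOf_grad25]
  simp [Matrix.trace, Fin.sum_univ_three]

/-- Reals `l₂ ≤ l₁` with `l₁ + l₂ + l₃ = 0` and `l₁ l₂ l₃ ≥ 0` have `l₂ ≤ 0` (only the upper ordering is needed):
the middle eigenvalue of a trace-free symmetric `3 × 3` matrix with `det ≥ 0` is `≤ 0`. [ours] -/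
theorem middle_nonpos_of_trace_zero_of_det_nonneg (l₁ l₂ l₃ : ℝ) (h₁₂ : l₂ ≤ l₁)
    (htr : l₁ + l₂ + l₃ = 0) (hdet : 0 ≤ l₁ * l₂ * l₃) : l₂ ≤ 0 := by
  by_contra h'
  have h : 0 < l₂ := lt_of_not_ge h'
  have h₁ : 0 < l₁ := lt_of_lt_of_le h h₁₂
  have h₃ : l₃ < 0 := by linarith
  have : l₁ * l₂ * l₃ < 0 := mul_neg_of_pos_of_neg (mul_pos h₁ h) h₃
  linarith

/-- Mirror: `l₃ ≤ l₂`, zero sum and non-positive product give `0 ≤ l₂`. [ours] -/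
theorem middle_nonneg_of_trace_zero_of_det_nonpos (l₁ l₂ l₃ : ℝ) (h₂₃ : l₃ ≤ l₂)
    (htr : l₁ + l₂ + l₃ = 0) (hdet : l₁ * l₂ * l₃ ≤ 0) : 0 ≤ l₂ := by
  by_contra h'
  have h : l₂ < 0 := lt_of_not_ge h'
  have h₃ : l₃ < 0 := lt_of_le_of_lt h₂₃ h
  have h₁ : 0 < l₁ := by linarith
  have : 0 < l₁ * l₂ * l₃ := mul_pos_of_neg_of_neg (mul_neg_of_pos_of_neg h₁ h) h₃
  linarith

/-! ### The unshearing family `v_ε = (0, h(x), f(y + εh(x)))` -/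

/-- Gradient of `v_ε` at a point: `a = h'(x)`, `b = f'(y + εh(x))`;
`∂ₓv₂ = a`, `∂ₓv₃ = ε a b`, `∂_y v₃ = b`, all other entries `0`. [ours] -/
def unshearGrad (ε a b : ℝ) : Matrix (Fin 3) (Fin 3) ℝ := grad25 0 0 a 0 (ε * a * b) b

/-- `ω(v_ε) = (b, −ε a b, a)` = `(f', −ε h' f', h')`. [ours, bookkeeping] -/
theorem unshear_vorticity (ε a b : ℝ) : vorticityOfGrad (unshearGrad ε a b) = ![b, -(ε * a * b), a] := by
  rw [unshearGrad, vorticity_grad25]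
  simp

/-- `σ(v_ε) = −ε a² b²` = `−ε h'² f'²`. [ours] -/
theorem unshear_sigma (ε a b : ℝ) : sigmaOf (unshearGrad ε a b) = -(ε * a ^ 2 * b ^ 2) := by
  rw [unshearGrad, sigma_grad25]
  ring

/-- `det S(v_ε) = ε a² b² / 4`. [ours] -/
theorem unshear_det (ε a b : ℝ) : (strainOf (unshearGrad ε a b)).det = ε * a ^ 2 * b ^ 2 / 4 := by
  rw [unshearGrad, det_strain_grad25]
  ring

/-- `tr S(v_ε) = 0` (divergence-free). [ours, bookkeeping] -/
theorem unshear_trace (ε a b : ℝ) : (strainOf (unshearGrad ε a b)).trace = 0 := by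
  rw [unshearGrad, trace_strain_grad25]
  ring

/-- For `ε ≥ 0` the stretching density is non-positive everywhere: `α = σ/|ω|² ≤ 0`,
so the C3a multiplier `‖α⁺‖∞` vanishes on `v_ε`. [ours] -/
theorem unshear_sigma_nonpos (ε a b : ℝ) (hε : 0 ≤ ε) : sigmaOf (unshearGrad ε a b) ≤ 0 := by
  rw [unshear_sigma]
  have : 0 ≤ ε * a ^ 2 * b ^ 2 := by positivity
  linarith

/-- For `ε ≥ 0`, `det S ≥ 0`; with `tr S = 0` and `middle_nonpos_of_trace_zero_of_det_nonneg`
the middle strain eigenvalue is `≤ 0` everywhere, so the C3b multiplier `‖λ₂⁺‖∞` vanishes on `v_ε`. [ours] -/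
theorem unshear_det_nonneg (ε a b : ℝ) (hε : 0 ≤ ε) : 0 ≤ (strainOf (unshearGrad ε a b)).det := by
  rw [unshear_det]
  positivity

/-- `σ < 0` strictly where `ε > 0`, `h' ≠ 0`, `f' ≠ 0`: the family is NOT in the classes
`𝒵₀ = {σ ≡ 0}` / `𝒵 = {λ₂ ≡ 0}` — it is compressed, not neutral. [ours] -/
theorem unshear_sigma_neg (ε a b : ℝ) (hε : 0 < ε) (ha : a ≠ 0) (hb : b ≠ 0) :
    sigmaOf (unshearGrad ε a b) < 0 := by
  rw [unshear_sigma]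
  have : 0 < ε * a ^ 2 * b ^ 2 := by positivity
  linarith

/-! ### The signed-phase shear family `v = (g(y), 0, W(x + φ(y)))` with `φ' g' ≥ 0` (Design C-III, NOGO N19 (e))

At a point put `c = g'(y)`, `t = φ'(y)`, `w = W'(x + φ(y))`. Then `∂_y v₁ = c`, `∂ₓ v₃ = w`, `∂_y v₃ = t w`
and every other entry of the velocity gradient vanishes. The unshearing family above is the diagonal case
`φ = ε g` (after exchanging the roles of `x` and `y`); here the phase `φ` is an independent profile, tied to
the shear only through the pointwise sign condition `φ' g' ≥ 0`, which is what lets the no-go branch place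
the compression `{σ < 0} = {g' φ' ≠ 0} ∩ {W' ≠ 0}` on any sub-band of the shear layer. [ours] -/

/-- Gradient of the signed-phase shear at a point (`c = g'`, `t = φ'`, `w = W'`). [ours] -/
def spsGrad (c t w : ℝ) : Matrix (Fin 3) (Fin 3) ℝ := grad25 0 c 0 0 w (t * w)

/-- `ω = (φ' W', −W', −g')`. [ours, bookkeeping] -/
theorem sps_vorticity (c t w : ℝ) : vorticityOfGrad (spsGrad c t w) = ![t * w, -w, -c] := by
  rw [spsGrad, vorticity_grad25]
  simp

/-- `σ = ω·Sω = −g' φ' W'²`. [ours] -/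
theorem sps_sigma (c t w : ℝ) : sigmaOf (spsGrad c t w) = -(c * t * w ^ 2) := by
  rw [spsGrad, sigma_grad25]
  ring

/-- `det S = g' φ' W'² / 4 = −σ/4`. [ours] -/
theorem sps_det (c t w : ℝ) : (strainOf (spsGrad c t w)).det = c * t * w ^ 2 / 4 := by
  rw [spsGrad, det_strain_grad25]
  ring

/-- `tr S = 0` (divergence-free). [ours, bookkeeping] -/
theorem sps_trace (c t w : ℝ) : (strainOf (spsGrad c t w)).trace = 0 := by
  rw [spsGrad, trace_strain_grad25]
  ring

/-- SIGN CONDITION: where `φ' g' ≥ 0` the stretching density is `≤ 0` — so if `φ' g' ≥ 0` at every point,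
`α = σ/|ω|² ≤ 0` everywhere and the C3a multiplier `‖α⁺‖∞` vanishes although `σ ≢ 0`. [ours] -/
theorem sps_sigma_nonpos (c t w : ℝ) (hct : 0 ≤ c * t) : sigmaOf (spsGrad c t w) ≤ 0 := by
  rw [sps_sigma]
  have : 0 ≤ c * t * w ^ 2 := mul_nonneg hct (sq_nonneg w)
  linarith

/-- … and `det S ≥ 0`, hence (with `tr S = 0` and `middle_nonpos_of_trace_zero_of_det_nonneg`) the middle strain
eigenvalue is `≤ 0` everywhere: the C3b multiplier `‖λ₂⁺‖∞` vanishes too. [ours] -/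
theorem sps_det_nonneg (c t w : ℝ) (hct : 0 ≤ c * t) : 0 ≤ (strainOf (spsGrad c t w)).det := by
  rw [sps_det]
  have : 0 ≤ c * t * w ^ 2 := mul_nonneg hct (sq_nonneg w)
  linarith

/-- Strict compression exactly where `g' φ' > 0` and `W' ≠ 0`. [ours] -/
theorem sps_sigma_neg (c t w : ℝ) (hct : 0 < c * t) (hw : w ≠ 0) : sigmaOf (spsGrad c t w) < 0 := by
  rw [sps_sigma]
  have hw2 : 0 < w ^ 2 := by positivity
  have : 0 < c * t * w ^ 2 := mul_pos hct hw2
  linarith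

/-- The unshearing family is the diagonal case: with `t = ε c` the signed-phase `σ` is `−ε c² w²`. [ours, bookkeeping] -/
theorem sps_sigma_diagonal (ε c w : ℝ) : sigmaOf (spsGrad c (ε * c) w) = -(ε * c ^ 2 * w ^ 2) := by
  rw [sps_sigma]
  ring

end Summit.NavierStokesRegularity.FunctionalMining.NoGo.Unshear
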